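import Summits.QuantumFields.BalabanUV.T4Continuum.Support.ShellMeasureLandauEndRayStokesAssembledDecay
import Summits.QuantumFields.BalabanUV.T4Continuum.Support.ShellMeasureLandauEndFinalToy

/-!
# `T4Continuum.ShellMeasureLandauEndAssembledToy` — NON-VACUITY OF THE MOST-ASSEMBLED DECLARATION: leaf-04's one-plaquette
# `SU(2)` model (row S88) inhabits EVERY hypothesis of S80 f3
# `ShellMeasureLandauEndRayStokesAssembledDecay.slotAC_realized_su2_landauChart_assembled_decay`, the (T2)∕(T3)∕(S78) supplier
# families included (rule G-1; t4-ref2 C-t4r2-381's (x1) flag on the END of record)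
(cell `pub-balaban`, sub-cell `t4`, spine estimate NE7c (node U5b); NE7c ROUND-2 crew, unit `b2b-balaban-t4-ne7c-formalise-leaf-01`
gen 8; OFFER on the journal «NON-VACUITY OF THE MOST-ASSEMBLED DECLARATION» against the owner's table
`t4/b2b-balaban-t4-ne7c-p1/LEAVES-NE7c-P1.md` rows S80∕S88 (R-ne7cp1-g32-4 ∕ R-g33-1 (c) ∕ R-g33-3 (a): the most-assembled
declaration of the END-II-final of record is S80 f3 `…_assembled_decay` p229913); ADDITIVE — imports S80 f3 (leaf-09-g12) and S88
`ShellMeasureLandauEndFinalToy` (leaf-04-g7: the model's data `b₁`, `toyCentre`, `toyF`, `toyU`, `toyReadOut`, `toyJco`, `toyεθ` and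
lemmas, ALL BY NAME) ONLY; [folklore]; 0 `def`, 0 `def … : Prop`, 0 sorry, 0 citation tags)

HONEST FRAMING.  A TOY: a CONSISTENCY CERTIFICATE of the ≈ 200-binder hypothesis list of the most-assembled live-level END —
nothing about Bałaban's minimiser, propagators, kernels or densities.  Finite four-torus programme, rung (B)+1 only — NOT
infinite volume, NOT a mass gap, NOT the Clay problem, NOT summit progress; NE7c (`T4IndicatorShell.ShellWeightBound`) NOT
PRINTED, NOT PROVED; «NE7c ⇐ the named binders» (c3); (M1) realized on a toy ≠ NE7c.  HONEST DEPENDENCY (cell): continuum YM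
on T⁴ ⇐ BetaPertH ∧ nine spine estimates (0/9 proved); BetaPertH ⇐ (D1) ∧ (D4) ∧ CAP+tail; G-an2-4 gates asym, D1 and NE2/3/4.

WHY (rule G-1, owner gen 32∕33; t4-ref2 pass 81 C-t4r2-381).  S88 `slotAC_final_toy` fires S76 f2 `…_final`, whose two 𝓔-slots are
abstract binders (`𝓔W = 𝓔E = 0` there); the most-assembled declaration S80 f3 ADDS the supplier families that DEFINE those slots —
(T2) the Wilson tuple AT THE READING OF RECORD (five flat pi-type chain spaces, one pin profile, the four linear letters as
V-indexed DECAY KERNELS with reduced-rate row sums, flat lists, two localities with reaches, block support, two contraction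
numbers, weight plaquettes with read-outs blind off located supports, flat∕curl op-norms, unitary frozen plaquettes with
`d_p ≤ d̄`, the located count `K_w`), (T3) the located non-Wilson terms' pinned tuple (S71 f2) and (S78) the fluctuation-dressed
`−log ∫ g e^{A} dμ` data — and the referee's flag asks whether THESE, jointly with the (T1)∕window∕dictionary families, are
inhabitable at all.  THIS FILE: yes — `slotAC_assembled_decay_toy` applies S80 f3 BY NAME with EVERY binder supplied: the (T1),
window, co-test, real-structure and dictionary data are leaf-04's S88 model VERBATIM (block `{b₁ p}`, `T = ∅`, covariant centre,
`toyF ≠ 0` by `toyF_one`, `toyU` non-constant, identity exponent field, one skew read-out), the (T2)∕(T3)∕(S78) families are met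
by EXPLICIT DEGENERATE-BUT-LEGAL data on NONEMPTY index sets (all index types `Unit`, fibres `ℂ`; zero decay kernels with
constants `c = 0`, row sums `M = 1`; `W𝒱 = 0`, `Φ = 0` (radius `1∕3 ≥ 2S`), `C = 0`; localities with reach `0`; ONE weight
plaquette `P_w = {()}` with ONE (zero) letter, frozen plaquette `1`, `d = d̄ = 0`, `K_w = 1`; ONE located term `I = {()}` with
`E = 0`, `L_K = 0`; the dressed slot on the one-point probability space with `g = 1`, `A = 0`, `B_d = 0`; `β = 0`), the depth
`ρ ∈ [0, ¼]` SYMBOLIC (leaf-04-g8's remark l.19008: at `ρ = ¼` the (M1) inequality is automatic, so the certificate is stated for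
every admissible `ρ`).  If some family had NOT been jointly inhabitable with the rest, that would have been a FINDING; none arose.
WHAT THIS DOES NOT DO: exercise the (T2)∕(T3) estimates non-trivially (the kernels are zero) — the point is JOINT INHABITATION of
the hypothesis list, exactly as S88; the positive shell mass is leaf-04-g8's S88 measure file.  NOTHING in the countdown moves.
-/

noncomputable section

open Set Metric NormedSpace MeasureTheory Function

namespace Summit.QuantumFields.BalabanUV.T4Continuum.ShellMeasureLandauEndAssembledToy

open scoped ENNReal Matrix.Norms.L2Operator
open Literature.MathematicalPhysics.QuantumFieldTheory.Balaban1983to89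
open B11Prop6Scheme (Prop4Hyp)
open GaugeField (GaugeInvariant plaqHol)
open T4ShellMeasure (SlotAntiConcentration)
open T4CubePoincare (cube mem_cube_iff)
open T4CubeChartGnomonic (SU2)
open T4CubeChartExp (expPt expFibreChart)
open T4TreeGaugeFixing (NoClosedLoop fixTo noClosedLoop_empty fixTo_empty)
open T4ExpWindowSmallField (dist1_expPt_eq dist1_eq_norm_coe_sub_one)
open T4ShellMeasurePlaquette (expTail₂)
open ShellMeasureLevelAssembly (classifier)
open ShellMeasureWilsonWords (wordExp wordExp_cons wordExp_nil)
open ShellMeasureMultiGridNorms (WSup)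
open ShellMeasurePinnedNorm (pinW)
open ShellMeasureDecayKernelSums (kerOp kerOp_apply)
open ShellMeasureLandauHolonomy (solAt landauExp)
open ShellMeasureLandauHolonomyChart (holOf cplx holOf_apply)
open ShellMeasureLandauHolonomySkew (readOutReal)
open ShellMeasureWilsonRealizedSU2 (M₂ gen coe_chart gen_mem_skewAdjoint)
open ShellMeasureLandauEndFinalToy (b₁ toyCentre toyF toyU toyReadOut toyJco toyεθ measurable_toyF measurable_toyU
  gaugeInvariant_toyF gaugeInvariant_toyU toyF_le_one toyF_one toyF_supp norm_toyReadOut_le toyReadOut_cplx solAt_zero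
  landauExp_zero smul_mem_cube toyF_section_mono toyεθ_pos dist1_plaqHol_section)
open ShellMeasureLandauEndRayStokesAssembledDecay (slotAC_realized_su2_landauChart_assembled_decay)

variable {P : Params} {j : ℕ}

/-! ## §1 The degenerate supplier data: the operator of the zero kernel -/

/-- the operator of the ZERO kernel is zero. [folklore] -/
theorem kerOp_zero_apply {Λ Λ' 𝔄 𝔅 : Type*} [Fintype Λ] [NormedAddCommGroup 𝔄] [NormedSpace ℂ 𝔄] [NormedAddCommGroup 𝔅]
    [NormedSpace ℂ 𝔅] (f : Λ → 𝔄) : kerOp (fun (_ : Λ') (_ : Λ) => (0 : 𝔄 →L[ℂ] 𝔅)) f = 0 := by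
  funext c
  rw [kerOp_apply]
  simp

/-- … hence bounded by any `B·‖f‖`, `B ≥ 0`. [folklore] -/
theorem norm_kerOp_zero_le {Λ Λ' 𝔄 𝔅 : Type*} [Fintype Λ] [Fintype Λ'] [NormedAddCommGroup 𝔄] [NormedSpace ℂ 𝔄]
    [NormedAddCommGroup 𝔅] [NormedSpace ℂ 𝔅] {B : ℝ} (hB : 0 ≤ B) (f : Λ → 𝔄) :
    ‖kerOp (fun (_ : Λ') (_ : Λ) => (0 : 𝔄 →L[ℂ] 𝔅)) f‖ ≤ B * ‖f‖ := by
  rw [kerOp_zero_apply, norm_zero]; positivity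

/-! ## §2 THE MOST-ASSEMBLED END APPLIED BY NAME TO THE TOY DATA -/

/-- **NON-VACUITY OF THE MOST-ASSEMBLED DECLARATION.**  For every lattice `P`, level `j`, plaquette `p`, enumeration `e` of the
`3` chart coordinates of the block `Λ = {b₁ p}`, window `0 < S < 1∕6` and depth `0 ≤ ρ ≤ ¼`: S80 f3
`ShellMeasureLandauEndRayStokesAssembledDecay.slotAC_realized_su2_landauChart_assembled_decay` APPLIED BY NAME to leaf-04's
one-plaquette model (the (T1)∕window∕co-test∕real-structure∕dictionary data of S88 VERBATIM) with the (T2)∕(T3)∕(S78) supplier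
families met by the explicit degenerate data of the header (nonempty index sets `P_w = I = {()}`, zero kernels, zero letters,
`β = 0`) yields (M1) for the toy slot — EVERY binder of the most-assembled END met by data of this file or S88's, none left as a
hypothesis; `F ≠ 0` (`toyF_one`), `Λ ≠ ∅`.  A consistency certificate; nothing about Bałaban's objects; NE7c NOT PROVED. [folklore] -/
theorem slotAC_assembled_decay_toy [DecidableEq (PBond P j)] (p : Plaq P j) {m₀ : ℕ}
    (e : ↥({b₁ p} : Finset (PBond P j)) × Fin 3 ≃ Fin m₀) {S ρ : ℝ} (hS : 0 < S) (hS6 : S < 1 / 6)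
    (hρ0 : 0 ≤ ρ) (hρ4 : ρ ≤ 1 / 4) :
    SlotAntiConcentration ((fieldMeasure P j SU2).withDensity (toyF S p)) (toyU p) (toyεθ S * 1 ^ 2) ρ
      (2 * ((m₀ : ℝ) + (3 * (|(0:ℝ)| * ((0 +
                2 * (1 * (0 * 1 * (1/6) / ((1 - 0 * 1 * (2 * 0 * (2/3) * Real.exp (0 * 0))) *
                    (1 - 2 * 0 * 2 * Real.exp (0 * 0) * (0 * 1) * (0 * 1)))) +
                  expTail₂ (((1:ℕ):ℝ) * (1 * (0 * 1 * (1/6) / ((1 - 0 * 1 * (2 * 0 * (2/3) * Real.exp (0 * 0))) *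
                    (1 - 2 * 0 * 2 * Real.exp (0 * 0) * (0 * 1) * (0 * 1))))))) / ((1/3) / S)) *
                (2 * (1 * (0 * 1 * (1/6) / ((1 - 0 * 1 * (2 * 0 * (2/3) * Real.exp (0 * 0))) *
                    (1 - 2 * 0 * 2 * Real.exp (0 * 0) * (0 * 1) * (0 * 1)))) +
                  expTail₂ (((1:ℕ):ℝ) * (1 * (0 * 1 * (1/6) / ((1 - 0 * 1 * (2 * 0 * (2/3) * Real.exp (0 * 0))) *
                    (1 - 2 * 0 * 2 * Real.exp (0 * 0) * (0 * 1) * (0 * 1))))))) / ((1/3) / S))) * 1) +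
              (3 * (0 * (2 * (((1/6) + 1 * (1/6)) + 1 * (4 * 0 * ((1/6) + 1 * (1/6)) ^ 2)))) / ((1/3) / S - 1) + 0))) / (1 - 1/2)) := by
  have hSπ : 3 * S ^ 2 < Real.pi ^ 2 := by nlinarith [Real.pi_gt_three]
  have hRad : (1 / 6 : ℝ) / S - 1 ≠ 0 := by
    have h : 1 < (1 / 6) / S := by rw [lt_div_iff₀ hS]; linarith
    linarith
  refine slotAC_realized_su2_landauChart_assembled_decay (P := P) (j := j) (n := Fin 2)
    (𝒴 := Fin m₀ → ℂ) (𝒴' := Fin m₀ → ℂ) (𝒳 := Fin m₀ → ℂ) (𝒵 := Fin m₀ → ℂ) (ℬ := Fin m₀ → ℂ)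
    (T := ∅) noClosedLoop_empty 1 {b₁ p} e hS hSπ (toyCentre p) (measurable_toyF S p) (gaugeInvariant_toyF S p)
    (toyF_supp S p 1) (measurable_toyU p) (gaugeInvariant_toyU p) (ι := Unit) (Pu := {()})
    (Finset.singleton_nonempty ()) (fun _ => cube m₀ S) (toyJco S p e) (δ := 1 / 2) (ρ := ρ) (β := 0)
    (fun _ => 0) (fun _ _ => 0) (B₀ := 1) (C₄ := 0) (a₃ := 2 / 3) (ε₄ := 1 / 6)
    (fun _ f => by simp) (fun _ => ⟨fun Y _ => by simp, differentiableOn_const _⟩) one_pos le_rfl (by norm_num)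
    (dL := 1) (C₁ := 1) (B₃ := 1) (ε₁ := 1 / 12) zero_le_one zero_le_one (by norm_num) le_rfl (by norm_num)
    (by norm_num) (by norm_num)
    (fun _ => ContinuousLinearMap.id ℂ (Fin m₀ → ℂ)) (fun _ B => by simp) (fun _ => id) (rΦ := 1 / 6)
    (fun _ => differentiableOn_id) (fun _ => rfl)
    (fun _ z hz => by rw [mem_ball_zero_iff] at hz; simp only [id]; linarith) (by linarith)
    (fun _ _ => 0) (C₂ := 0) (RC := 1) le_rfl (fun _ Z _ => by simp) (fun _ => differentiableOn_const _)
    (fun _ => 0) (fun _ Y => by simp) (fun _ => 0) (fun _ X => by simp) (ε₃ := 1 / 3) (by norm_num) (by norm_num)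
    (by norm_num) (fun _ => [toyReadOut p e]) (κr := 3) (by norm_num)
    (fun _ _ ℓ hℓ Y => by rw [List.mem_singleton.1 hℓ]; exact norm_toyReadOut_le p e Y) (m := 1)
    (fun _ _ => by simp) (κc := 3) (by norm_num)
    (fun _ _ Y => by simpa using norm_toyReadOut_le p e Y)
    -- ══ (T2): index types `Unit`, fibres `ℂ`, zero pin profile and distance, zero decay kernels ══
    (Λw := Unit) (Λz := Unit) (Λw' := Unit) (Λx := Unit) (Λb := Unit) (𝔖 := Unit)
    (𝔄w := ℂ) (ℭ := ℂ) (𝔄' := ℂ) (𝔅 := ℂ) (𝔇 := ℂ)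
    (δw := 0) le_rfl (fun _ => 0) (fun _ _ => 0) (fun _ _ => by simp) id id id id id
    (fun _ _ _ => 0) (fun _ _ _ => 0) (fun _ _ _ => 0) (fun _ _ _ => 0)
    (c𝒢 := 0) (δ𝒢 := 0) (M𝒢 := 1) (cι := 0) (δι := 0) (Mι := 1) (cH := 0) (δH := 0) (MH := 1)
    (cH₁ := 0) (δH₁ := 0) (MH₁ := 1)
    le_rfl zero_le_one (fun _ _ _ => by simp) (fun _ => by simp)
    le_rfl zero_le_one (fun _ _ _ => by simp) (fun _ => by simp)
    le_rfl zero_le_one (fun _ _ _ => by simp) (fun _ => by simp)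
    le_rfl zero_le_one (fun _ _ _ => by simp) (fun _ => by simp)
    -- the flat lists of the Wilson tuple
    (fun _ _ => 0) (B₀w := 1) (C₄w := 0) (a₃w := 2 / 3) (ε₄w := 1 / 6) (bw := 1 / 6)
    (fun _ f => norm_kerOp_zero_le zero_le_one f) (fun _ => ⟨fun Y _ => by simp, differentiableOn_const _⟩) one_pos le_rfl
    (by norm_num) (by norm_num) (by norm_num) (by norm_num) (fun _ B => norm_kerOp_zero_le zero_le_one B)
    (fun _ _ => 0) (rΦw := 1 / 3) (fun _ => differentiableOn_const _) (fun _ => rfl)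
    (fun _ z _ => by simp) (by linarith)
    (fun _ _ => 0) (C₂w := 0) (RCw := 2) le_rfl (fun _ Z _ => by simp) (fun _ => differentiableOn_const _)
    (fun _ Y => by simpa using norm_kerOp_zero_le zero_le_one Y) (fun _ X => norm_kerOp_zero_le zero_le_one X)
    (by norm_num) (by norm_num)
    -- localities (trivial), reaches `0`, block support, the two contraction numbers
    (fun _ _ => True) (fun _ A A' c' _ => rfl) (rW := 0) (fun _ _ _ => by simp)
    (fun _ _ => True) (fun _ A A' c' _ => rfl) (rC := 0) (fun _ _ _ => by simp)
    (fun _ z i _ => rfl) (by norm_num) (by norm_num)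
    -- ONE weight plaquette with ONE zero letter
    (𝔭 := Unit) {()} (fun _ => [0]) (fun _ => ∅) (fun _ => 0)
    (fun _ _ ℓ _ A A' _ => by simp_all) (fun _ _ b' hb' => absurd hb' (Finset.notMem_empty _)) (fun _ _ => le_rfl)
    (κwb := 1) (κcb := 1) zero_le_one zero_le_one
    (fun _ _ ℓ hℓ => by
      rw [List.mem_singleton.1 hℓ]; exact ContinuousLinearMap.opNorm_le_bound _ zero_le_one fun Y => by simp)
    (fun _ _ => by
      rw [List.sum_cons, List.sum_nil, add_zero]
      exact ContinuousLinearMap.opNorm_le_bound _ zero_le_one fun Y => by simp)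
    (mw := 1) (fun _ _ => by simp)
    -- the Wilson tuple's real structure: everything
    ⊤ (by simp) ⊤ ⊤ ⊤ (by simp) ⊤
    (fun _ f _ => AddSubgroup.mem_top _) (fun _ Y _ => AddSubgroup.mem_top _) (fun _ Y _ => AddSubgroup.mem_top _)
    (fun _ X _ => AddSubgroup.mem_top _) (fun _ Z _ => AddSubgroup.mem_top _) (fun _ B _ => AddSubgroup.mem_top _)
    (fun _ y _ => AddSubgroup.mem_top _)
    (fun _ _ ℓ hℓ Y _ => by rw [List.mem_singleton.1 hℓ]; simp)
    -- frozen plaquettes `1`, `d = d̄ = 0`, located count `K_w = 1`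
    (fun _ _ => 1) (d := fun _ => 0) (dbar := 0) (fun _ _ _ => (unitary _).one_mem) (fun _ _ _ => by simp)
    (fun _ _ => le_rfl) le_rfl (Kw := 1) (by simp)
    -- ══ (T3): the located terms' pinned tuple on `Unit → ℂ`, all operators zero, ONE zero term ══
    (Λe := Unit) (𝔄 := ℂ) (δ' := 0) (ϖ := fun _ => 0) le_rfl (fun _ => le_rfl)
    (𝒴e' := ℂ) (𝒳e := ℂ) (𝒵e := ℂ) (ℬe := ℂ)
    (fun _ => 0) (fun _ _ => 0) (B₀e := 1) (C₄e := 0) (a₃e := 2 / 3) (be := 1 / 6) (ε₄e := 1 / 6)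
    (fun _ f => by simp) (fun _ => ⟨fun Y _ => by simp, differentiableOn_const _⟩) one_pos le_rfl (by norm_num)
    (by norm_num) (by norm_num) (by norm_num) (by norm_num)
    (fun _ => 0) (fun _ B => by simp) (fun _ _ => 0) (rΦe := 1 / 3) (fun _ => differentiableOn_const _)
    (fun _ => rfl) (fun _ z _ => by simp) (by linarith)
    (fun _ _ => 0) (C₂e := 0) (RCe := 1) le_rfl (fun _ Z _ => by simp) (fun _ => differentiableOn_const _)
    (fun _ => 0) (fun _ Y => by simp) (fun _ => 0) (fun _ X => by simp) (by norm_num) (by norm_num)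
    (𝔱 := Unit) {()} (Ef := fun _ _ => 0) (rE := 1) (ee := fun _ => 0) one_pos
    (fun _ _ => differentiableOn_const _) (fun _ _ Z _ => by simp) (fun _ _ => le_rfl)
    (fun _ => ∅) (fun _ _ A₁ A₂ _ => rfl) (fun _ => 0) (fun _ _ b' hb' => absurd hb' (Finset.notMem_empty _))
    (LK := 0) le_rfl (by simp) (by norm_num) (BE₁ := 0) (fun _ y _ => by simp)
    -- ══ (S78): the one-point probability space, `g = 1`, `A = 0`, `B_d = 0` ══
    (Ω := Unit) (Measure.dirac ()) (g := fun _ => 1) (fun _ => zero_le_one) (fun _ _ _ => 0) (Bd := 0) le_rfl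
    (fun _ x _ c' _ _ => by simp)
    (fun _ x _ c' _ _ => by simp) (fun _ x _ c' _ _ ω => by simp) (BE₂ := 0) (fun _ y _ => by simp)
    -- the (T1) real structure and the dictionary (S88 VERBATIM), co-tests, numbers
    {toyReadOut p e} ⊤ ⊤ ⊤ (by simp) (readOutReal {toyReadOut p e})
    (fun _ f _ => by simp) (fun _ Y _ => AddSubgroup.mem_top _)
    (fun _ Y _ => AddSubgroup.mem_top _) (fun _ X _ => by simp)
    (fun _ Z _ => AddSubgroup.mem_top _) (fun _ B hB => by simpa using hB)
    (fun _ y _ => ?_) (fun V x hx => ?_) (fun V x _ => ?_)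
    (fun V x hJ => ?_) (fun V x a ha => ?_) (fun V x => ?_) (fun _ => ShellMeasureLandauHolonomyPrint.chartCube_subset_closedBall hS.le)
    (by norm_num) (by norm_num) hρ0 (by linarith) le_rfl (η := 1) (εθ := toyεθ S) (c₁ := 1) (c₂ := 1)
    (z := 1) one_pos (toyεθ_pos hS hS6) (by norm_num) (by norm_num) (by norm_num) ?_
  · -- `hΦr`
    intro ℓ hℓ
    rw [Set.mem_singleton_iff.1 hℓ]
    show toyReadOut p e (cplx y) ∈ skewAdjoint M₂
    rw [toyReadOut_cplx]; exact gen_mem_skewAdjoint _ _ _ _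
  · -- `hRdict`: `F(section x) = Jco V x · e^{−(0 + (0 + 0))}` on the cube — the three DEFINED profiles vanish on the toy data
    rw [fixTo_empty, toyJco, indicator_of_mem hx]
    simp
  · -- `hudict` (S88's dictionary VERBATIM)
    have h1 : expFibreChart {b₁ p} (1 : GaugeField P j SU2) e x ⟨b₁ p, Finset.mem_singleton_self _⟩ =
        expPt (fun i => x (e (⟨b₁ p, Finset.mem_singleton_self _⟩, i))) :=
      show (1 : SU2) * _ = _ from one_mul _
    rw [fixTo_empty, toyU, dist1_plaqHol_section, dist1_eq_norm_coe_sub_one, ← h1, coe_chart]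
    simp only [classifier, Finset.sup'_singleton, holOf_apply, List.map_cons, List.map_nil, wordExp_cons, wordExp_nil,
      mul_one, landauExp_zero, solAt_zero _ (by norm_num : (0 : ℝ) ≤ 1 / 6), zero_add, ContinuousLinearMap.coe_id',
      id, toyReadOut_cplx]
  · -- `hJW`
    by_contra h
    exact hJ (indicator_of_notMem h _)
  · -- `hJ`
    unfold toyJco
    by_cases hx : x ∈ cube m₀ S
    · rw [indicator_of_mem hx, indicator_of_mem (smul_mem_cube hx ha)]
      exact toyF_section_mono hSπ p e V hx ha
    · rw [indicator_of_notMem hx]; exact bot_le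
  · -- `hJ1`
    unfold toyJco
    by_cases hx : x ∈ cube m₀ S
    · rw [indicator_of_mem hx]; exact toyF_le_one S p _
    · rw [indicator_of_notMem hx]; exact bot_le
  · -- `hsm`: (SM) with equality (S88)
    unfold toyεθ
    rw [show (36 : ℝ) * (1 * 1 + ((1 : ℕ) : ℝ) ^ 2 * 1 ^ 2 * 1 ^ 2) = 72 by norm_num,
      show (1 / 2 : ℝ) * (144 / ((1 / 6) / S - 1) ^ 2) = 72 / ((1 / 6) / S - 1) ^ 2 by ring]

end Summit.QuantumFields.BalabanUV.T4Continuum.ShellMeasureLandauEndAssembledToy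

end
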